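import Mathlib
import Literature.Analysis.FluidPDE.ClassicalSolution
import Literature.Analysis.FluidPDE.LerayHopf
import Literature.Analysis.FluidPDE.BarkerPrangeConcentrationHolds
import Literature.Analysis.FluidPDE.NSSereginEnergyApproximants
import Literature.Analysis.FluidPDE.NSCriticalClosureProofs
import Literature.Analysis.FluidPDE.NSCriticalClosureBesovKatoClass
import Literature.Analysis.FluidPDE.TaoLocalisationHolds
import Summits.NavierStokesRegularity.NavierStokesRegularity.Theses.L3TimeExponentPincer
import Summits.NavierStokesRegularity.NavierStokesRegularity.Theorems.L3TimeExponentPincerEffNode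
import Summits.NavierStokesRegularity.NavierStokesRegularity.Theorems.L3TimeExponentPincerPaceDichotomy
import Summits.NavierStokesRegularity.NavierStokesRegularity.Theorems.L3TimeExponentPincerEffSatBlowupStubParabolicConcentrationBlowup
import HarnessLib.Audit
import HarnessLib

/-!
# On the Morrey-Type-I class of line `pace` the critical norm concentrates at a FIXED centre
# (Barker–Prange 2020, Thm. 2, for the route's frame) — crux `EffSatBlowup`, route `L3TimeExponentPincer`

Support file (cell ns-regularity-ideate, seat p4; `--supports stmt-NavierStokesRegularity-19139 --as helper`).

Line `pace` (planner p2, ROUND-8) cuts the crux `EffSatBlowup` by the Morrey-Type-I bound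
`MorreyTypeINear u T` (`∫_{B(x₀,r)} |u(t)|² ≤ M r` for all centres, all `r < r₁`, all `T - r² < t < T`;
Barker–Prange 2020 (1.7) in energy spelling): stub 2 `stub_morreyTypeI_slow` lives ON that class, stub 3 off
it.  This file records what print knows about the blow-up geometry ON the class: the critical norm does not
only concentrate in SOME parabolic ball at each late time (`l3ParabolicConcentration_of_blowup`, every frame
blow-up, moving centre `x₀(t)` — Kang–Miura–Tsai 2021), it concentrates in the parabolic balls around ONE
point — any singular point `x₀` of the blow-up time — at ALL late times:

* §1 `l3Concentration_at_singularPoint_of_isLerayHopfOn` — Barker–Prange 2020, **Theorem 2**, for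
  Leray–Hopf solutions on a finite interval `[0,T)` regular on the open strip (the tree's discharged named fact
  `BarkerPrange2020_thm2` is stated for GLOBAL Leray–Hopf solutions; its printed proof, formalised as
  `BarkerPrange2020_thm2_of_localizedSmoothing`, only uses the solution before `T` and is replayed verbatim
  with the finite-interval restart `IsLerayHopfOn.exists_isLocalEnergySolutionOn_restart`): under
  `‖u(t)‖_{L²(B_r(y))} ≤ M ν √r` (`0 < r < r₀`, `T - r²/ν < t < T`), at a singular point `(T, x₀)`,
  `‖u(t)‖_{L³(|x - x₀| ≤ 2√(ν(T-t)/S(M)))} > γ ν` for all `t ∈ (max(0, T - S r₀²/ν), T)`.  §2 the frame: `morreyBP_of_morreyTypeINear` converts the pace-line predicate `MorreyTypeINear` into the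
  Barker–Prange form (radius inflation `r ↦ r√(1 + 2/ν)` absorbs the viscosity in the time window);
  `exists_fixedCentre_l3Concentration_of_morreyTypeINear` — every frame blow-up (classical on `[0,T)`,
  Leray–Hopf from a rapidly decaying datum, no smooth extension past `T`) of the Morrey-Type-I class has a
  point `x₀` and constants `γ₃, c > 0` with `γ₃ < ‖u(t)‖_{L³(closedBall x₀ (c√(T-t)))}` on a final window
  (singular point from `exists_singularPoint_of_classical_of_not_hasSmoothExtensionPast`, interior regularity
  from Tao's closed-slab bounds); `fixedCentre_l3Concentration_of_typeI_blowup` — in particular for every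
  sup-Type-I frame blow-up (`morreyTypeINear_of_typeI'`, the tree's uniform Morrey bound).

Placement for the line: on the class of stub 2 an `L³`-mass `γν` is pinned to the parabolic neighbourhood of
one singular point at every late time; nothing here bounds `‖u(t)‖₃` from ABOVE (stub 2 itself stays open).

WHAT THIS IS NOT: not a claim about Navier–Stokes regularity or blow-up; a printed theorem moved to the
route's frame, kernel-checked, landed `--supports`; the crux `EffSatBlowup` and its stubs 2–3 stay open.

References: T. Barker, C. Prange, ARMA 236 (2020) = arXiv:1812.09115, Thm. 2 (pp. 4–5), §4.2 (p. 16)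
[BarkerPrange2020]; T. Tao, Anal. PDE 6 (2013), Cor. 11.1 [Tao2011]; P. G. Lemarié-Rieusset (2016),
Thm. 15.1 (C) [LemarieRieusset2016].
-/

noncomputable section

open MeasureTheory Set Function Filter Metric Topology
open scoped ENNReal NNReal Topology
open Literature.Analysis.FluidPDE
open Summit.NavierStokesRegularity.NavierStokesRegularity.Theorems.L3TimeExponentPincerEffNode
open Summit.NavierStokesRegularity.NavierStokesRegularity.Theorems.L3TimeExponentPincerPaceDichotomy
open Summit.NavierStokesRegularity.NavierStokesRegularity.Theorems.L3TimeExponentPincerStubParabolicConcentration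

namespace Summit.NavierStokesRegularity.NavierStokesRegularity.Theorems.L3TimeExponentPincerMorreyTypeIFixedCentre

/-! ## §1  Barker–Prange 2020, Theorem 2, for Leray–Hopf solutions on a finite interval -/

/-- **Barker–Prange 2020, Theorem 2, on a finite interval.**  There are a universal `γ > 0` and, for every
`M > 0`, a time `S = S*(M) ∈ (0, ¼]` (those of their Theorem 1, tree: `BarkerPrange2020_thm1_slab`) such that:
for `ν, T, r₀ > 0` and a Leray–Hopf solution `u` of the unforced system on `[0,T)` which is regular at every
point of the open strip `0 < t < T` and obeys the Type-I bound `‖u(t)‖_{L²(B_r(y))} ≤ M ν √r` for all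
centres `y`, radii `0 < r < r₀` and times `0 < t`, `T - r²/ν < t < T`, at every singular point `(T, x₀)`
(`u` essentially unbounded on each backward cylinder `(T - r², T) × B_r(x₀)`) one has
`γ ν < ‖u(t)‖_{L³(|x - x₀| ≤ 2√(ν(T-t)/S))}` for all `t ∈ (max(0, T - S r₀²/ν), T)`.  The printed proof
(§4.2: restart at `t`, rescale by the similarity scale `λ = √(ν(T-t)/S)`, Theorem 1 on the slab, transport
back to a backward cylinder at `(T, x₀)`), exactly as formalised in the tree's
`BarkerPrange2020_thm2_of_localizedSmoothing`, with the finite-interval restart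
`IsLerayHopfOn.exists_isLocalEnergySolutionOn_restart`; the global-in-time hypothesis of the named fact
`BarkerPrange2020_thm2` is not needed. [cite: BarkerPrange2020, Thm. 2 (arXiv:1812.09115 pp. 4–5) with §4.2 (p. 16)] -/
theorem l3Concentration_at_singularPoint_of_isLerayHopfOn :
    ∃ γ : ℝ, 0 < γ ∧ ∀ M : ℝ, 0 < M → ∃ S : ℝ, 0 < S ∧ S ≤ 1 / 4 ∧
      ∀ (ν T r₀ : ℝ), 0 < ν → 0 < T → 0 < r₀ →
        ∀ (u₀ : EuclideanSpace ℝ (Fin 3) → EuclideanSpace ℝ (Fin 3))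
          (u : ℝ → EuclideanSpace ℝ (Fin 3) → EuclideanSpace ℝ (Fin 3)),
          IsLerayHopfOn T ν 0 u₀ u →
          (∀ (y : EuclideanSpace ℝ (Fin 3)) (r : ℝ), 0 < r → r < r₀ →
            ∀ t : ℝ, 0 < t → T - r ^ 2 / ν < t → t < T →
              eLpNorm (u t) 2 (volume.restrict (ball y r)) ≤ ENNReal.ofReal (M * ν * Real.sqrt r)) →
          (∀ t ∈ Ioo 0 T, ∀ x : EuclideanSpace ℝ (Fin 3), IsRegularPoint u (t, x)) →
          ∀ x₀ : EuclideanSpace ℝ (Fin 3),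
            (∀ r : ℝ, 0 < r → r ^ 2 < T →
              eLpNorm (uncurry u) ∞ (volume.restrict (parabolicCylinder r ((T : ℝ), x₀))) = ∞) →
            ∀ t ∈ Ioo (max 0 (T - S * r₀ ^ 2 / ν)) T,
              ENNReal.ofReal (γ * ν) <
                eLpNorm (u t) 3 (volume.restrict (closedBall x₀ (2 * Real.sqrt (ν * (T - t) / S)))) := by
  obtain ⟨γ, hγ, hT1⟩ := BarkerPrange2020_thm1_slab
  refine ⟨γ, hγ, fun M hM => ?_⟩
  obtain ⟨S, hS, hS4, hsm⟩ := hT1 M hM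
  refine ⟨S, hS, hS4, fun ν T r₀ hν hT hr₀ u₀ u hLH hTypeI hReg x₀ hSing t ht => ?_⟩
  have hS1 : S < 1 := by linarith
  have ht0 : 0 < t := lt_of_le_of_lt (le_max_left _ _) ht.1
  have htS : T - S * r₀ ^ 2 / ν < t := lt_of_le_of_lt (le_max_right _ _) ht.1
  have htT : t < T := ht.2
  have hTt : 0 < T - t := sub_pos.2 htT
  by_contra hcon
  rw [not_lt] at hcon
  -- the similarity scale `λ`, `λ² = ν (T - t) / S`
  have hpos : 0 < ν * (T - t) / S := div_pos (mul_pos hν hTt) hS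
  obtain ⟨l, hl_def, hl, hl2⟩ :
      ∃ l : ℝ, l = Real.sqrt (ν * (T - t) / S) ∧ 0 < l ∧ l ^ 2 = ν * (T - t) / S :=
    ⟨_, rfl, Real.sqrt_pos.2 hpos, Real.sq_sqrt hpos.le⟩
  rw [← hl_def] at hcon
  have hν0 : ν ≠ 0 := hν.ne'
  have hS0 : S ≠ 0 := hS.ne'
  have hl0 : l ≠ 0 := hl.ne'
  have hTt0 : T - t ≠ 0 := hTt.ne'
  have hβ : 0 < l ^ 2 / ν := by positivity
  have hl2ν : l ^ 2 / ν = (T - t) / S := by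
    rw [hl2]; field_simp
  -- `λ < r₀` (the choice of `t_*`)
  have hlr₀ : l < r₀ := by
    have h1 : T - t < S * r₀ ^ 2 / ν := by linarith
    have h2 : ν * (T - t) / S < r₀ ^ 2 := by
      rw [lt_div_iff₀ hν] at h1
      rw [div_lt_iff₀ hS]
      nlinarith
    rw [← Real.sqrt_sq hr₀.le, hl_def]
    exact Real.sqrt_lt_sqrt hpos.le h2
  -- the time window of the Type-I bound at radius `λ`: `T - λ²/ν < t` since `S < 1`
  have hwin : T - l ^ 2 / ν < t := by
    rw [hl2ν]
    have h1 : (T - t) * S < T - t := mul_lt_of_lt_one_right hTt hS1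
    have h2 : T - t < (T - t) / S := (lt_div_iff₀ hS).2 h1
    linarith
  -- the restarted solution (finite-interval restart), and the rescaled local energy solution of §4.2
  obtain ⟨π, hπ⟩ := hLH.exists_isLocalEnergySolutionOn_restart hν hT hReg (t₀ := t) ⟨ht0, htT⟩
  have hβeq : l ^ 2 / ν = l / ν * l := by
    rw [sq]; ring
  have hv := hπ.stRescale (div_pos hl hν) hl hβeq x₀
  have hslab : (T - t) / (l ^ 2 / ν) = S := by
    rw [hl2]; field_simp
  have hvisc : l / ν * ν / l = 1 := by
    field_simp
  have hfun : ((l / ν) • stPull (l ^ 2 / ν) l 0 x₀ fun s => u (t + s)) =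
      (l / ν) • stPull (l ^ 2 / ν) l t x₀ u := by
    funext s y
    simp only [smul_stPull_apply, zero_add]
  rw [hslab, hvisc, hfun] at hv
  -- its datum: in `L²`, hence in `E²`
  have hut : MemLp (u t) 2 volume := hLH.memLp t ⟨ht0.le, htT.le⟩
  have hv₀2 : MemLp (fun y => (l / ν) • u t (x₀ + l • y)) 2 volume :=
    (memLp_comp_add_smul hut x₀ hl).const_smul (l / ν)
  have hE2 : MemE2 (fun y => (l / ν) • u t (x₀ + l • y)) :=
    memE2_of_memLp hv₀2 le_rfl (by norm_num)
  have hsmul : ∀ q : ℝ≥0∞, ∀ μ : Measure (EuclideanSpace ℝ (Fin 3)),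
      eLpNorm (fun y => (l / ν) • u t (x₀ + l • y)) q μ =
        ‖l / ν‖ₑ * eLpNorm (fun y => u t (x₀ + l • y)) q μ := fun q μ => by
    rw [show (fun y => (l / ν) • u t (x₀ + l • y)) = (l / ν) • fun y => u t (x₀ + l • y)
      from rfl, eLpNorm_const_smul]
  have hlν : ‖l / ν‖ₑ = ENNReal.ofReal (l / ν) := Real.enorm_eq_ofReal (by positivity)
  -- `‖v₀‖_{L²(B₁(x̄))} ≤ M` from the Type-I bound at radius `λ`
  have hL2 : ∀ x₁ : (EuclideanSpace ℝ (Fin 3)), eLpNorm (fun y => (l / ν) • u t (x₀ + l • y)) 2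
      (volume.restrict (ball x₁ 1)) ≤ ENNReal.ofReal M := by
    intro x₁
    have hTI := hTypeI (x₀ + l • x₁) l hl hlr₀ t ht0 hwin htT
    have hsl : l * Real.sqrt l = Real.sqrt l ^ 3 := by
      calc l * Real.sqrt l = Real.sqrt l ^ 2 * Real.sqrt l := by rw [Real.sq_sqrt hl.le]
        _ = Real.sqrt l ^ 3 := by ring
    have hs0 : 0 < Real.sqrt l := Real.sqrt_pos.2 hl
    calc eLpNorm (fun y => (l / ν) • u t (x₀ + l • y)) 2 (volume.restrict (ball x₁ 1))
        = ‖l / ν‖ₑ * (ENNReal.ofReal ((l ^ 3)⁻¹) ^ (1 / (2 : ℝ≥0∞)).toReal *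
            eLpNorm (u t) 2 (volume.restrict (ball (x₀ + l • x₁) (l * 1)))) := by
          rw [hsmul, eLpNorm_comp_add_smul_ball (u t) x₀ x₁ hl 1 (by norm_num)]
      _ ≤ ‖l / ν‖ₑ * (ENNReal.ofReal ((Real.sqrt l ^ 3)⁻¹) *
            ENNReal.ofReal (M * ν * Real.sqrt l)) := by
          rw [ofReal_inv_cube_rpow_half hl, mul_one]
          gcongr
      _ = ENNReal.ofReal M := by
          rw [hlν, ← ENNReal.ofReal_mul (by positivity), ← ENNReal.ofReal_mul (by positivity)]
          congr 1
          rw [← hsl]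
          field_simp
  -- `‖v₀‖_{L³(B₂(0))} ≤ γ` from the assumed smallness at time `t`
  have hL3 : eLpNorm (fun y => (l / ν) • u t (x₀ + l • y)) 3
      (volume.restrict (ball (0 : (EuclideanSpace ℝ (Fin 3))) 2)) ≤ ENNReal.ofReal γ := by
    have h1 : eLpNorm (u t) 3 (volume.restrict (ball x₀ (2 * l))) ≤ ENNReal.ofReal (γ * ν) :=
      (eLpNorm_mono_measure _ (Measure.restrict_mono ball_subset_closedBall le_rfl)).trans hcon
    calc eLpNorm (fun y => (l / ν) • u t (x₀ + l • y)) 3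
          (volume.restrict (ball (0 : (EuclideanSpace ℝ (Fin 3))) 2))
        = ‖l / ν‖ₑ * (ENNReal.ofReal ((l ^ 3)⁻¹) ^ (1 / (3 : ℝ≥0∞)).toReal *
            eLpNorm (u t) 3 (volume.restrict (ball (x₀ + l • (0 : (EuclideanSpace ℝ (Fin 3)))) (l * 2)))) := by
          rw [hsmul, eLpNorm_comp_add_smul_ball (u t) x₀ 0 hl 2 (by norm_num)]
      _ ≤ ‖l / ν‖ₑ * (ENNReal.ofReal l⁻¹ * ENNReal.ofReal (γ * ν)) := by
          rw [ofReal_inv_cube_rpow_third hl, smul_zero, add_zero, mul_comm l 2]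
          gcongr
      _ = ENNReal.ofReal γ := by
          rw [hlν, ← ENNReal.ofReal_mul (by positivity), ← ENNReal.ofReal_mul (by positivity)]
          congr 1
          field_simp
  -- Theorem 1: the rescaled solution is bounded on `(S/2, S) × B_{1/3}(0)`
  have hbdd := hsm _ _ _ hv hE2 hL2 hL3 (S / 2) ⟨by linarith, by linarith⟩
  -- back to `u`: bounded on `(t + (T - t)/2, T) × B_{λ/3}(x₀)`
  have hpre : stAffine (l ^ 2 / ν) l t x₀ ⁻¹' (Ioo (t + (T - t) / 2) T ×ˢ ball x₀ (l / 3)) =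
      Ioo (S / 2) S ×ˢ ball (0 : (EuclideanSpace ℝ (Fin 3))) (1 / 3) := by
    rw [stAffine_preimage_cylinder hβ hl, hl2ν, sub_self, smul_zero]
    congr 1
    · congr 1
      · field_simp
        ring
      · field_simp
    · congr 1
      field_simp
  have hbdd' : eLpNorm (uncurry u) ∞
      (volume.restrict (Ioo (t + (T - t) / 2) T ×ˢ ball x₀ (l / 3))) < ∞ := by
    rw [← hpre, eLpNorm_top_uncurry_smul_stPull_preimage hβ hl] at hbdd
    rcases ENNReal.mul_lt_top_iff.1 hbdd with (⟨-, h⟩ | h | h)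
    · exact h
    · exact absurd h (by simp [hl0, hν0])
    · rw [h]; exact ENNReal.zero_lt_top
  -- a backward cylinder at `(T, x₀)` inside that box
  set r : ℝ := min (l / 3) (Real.sqrt ((T - t) / 2)) with hr_def
  have hr : 0 < r := lt_min (by positivity) (Real.sqrt_pos.2 (by positivity))
  have hr2 : r ^ 2 ≤ (T - t) / 2 := by
    have h1 : r ≤ Real.sqrt ((T - t) / 2) := min_le_right _ _
    have h2 : r ^ 2 ≤ Real.sqrt ((T - t) / 2) ^ 2 := pow_le_pow_left₀ hr.le h1 2
    rwa [Real.sq_sqrt (by positivity)] at h2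
  have hrT : r ^ 2 < T := by linarith
  have hsub : parabolicCylinder r ((T : ℝ), x₀) ⊆ Ioo (t + (T - t) / 2) T ×ˢ ball x₀ (l / 3) := by
    rintro ⟨s, y⟩ hz
    rw [mem_parabolicCylinder] at hz
    exact ⟨⟨by linarith [hz.1.1], hz.1.2⟩, mem_ball.2 (lt_of_lt_of_le hz.2 (min_le_left _ _))⟩
  have hlt : eLpNorm (uncurry u) ∞ (volume.restrict (parabolicCylinder r ((T : ℝ), x₀))) < ∞ :=
    (eLpNorm_mono_measure _ (Measure.restrict_mono hsub le_rfl)).trans_lt hbdd'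
  exact hlt.ne (hSing r hr hrT)

/-! ## §2  The frame: the Morrey-Type-I class of line `pace` -/

variable {ν T : ℝ} {u : ℝ → EuclideanSpace ℝ (Fin 3) → EuclideanSpace ℝ (Fin 3)}
  {p : ℝ → EuclideanSpace ℝ (Fin 3) → ℝ}

/-- `‖f‖_{L²(B)} = (∫_B ‖f‖²)^{1/2}` (Mathlib's `eLpNorm` at `p = 2`, restricted Lebesgue measure). [folklore] -/
theorem eLpNorm_two_restrict_eq_lintegral_rpow (f : EuclideanSpace ℝ (Fin 3) → EuclideanSpace ℝ (Fin 3))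
    (s : Set (EuclideanSpace ℝ (Fin 3))) :
    eLpNorm f 2 (volume.restrict s) = (∫⁻ x in s, ‖f x‖ₑ ^ 2) ^ (1 / 2 : ℝ) := by
  rw [eLpNorm_eq_lintegral_rpow_enorm_toReal (by norm_num) (by norm_num), ENNReal.toReal_ofNat]
  congr 1
  refine lintegral_congr fun x => ?_
  rw [← ENNReal.rpow_natCast]
  norm_num

/-- **`MorreyTypeINear` in the Barker–Prange spelling.**  The pace-line predicate
(`∫_{B(y,r)} |u(t)|² ≤ M r` for `0 < r < r₁`, `T - r² < t < T`) yields the Type-I bound (1.7) of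
Barker–Prange 2020 with viscosity, `‖u(t)‖_{L²(B_r(y))} ≤ M' ν √r` for `0 < r < r₀`, `T - r²/ν < t < T`:
inflate the radius to `r' = r√(1 + 2/ν)` (`r'² > r²/ν > T - t`, so the pace-line window applies at `r'`)
and use `B_r ⊆ B_{r'}`; `r₀ = r₁/√(1 + 2/ν)`, `M' = √(M√(1 + 2/ν))/ν`.
[cite: BarkerPrange2020, (1.7) and the remark p. 5] -/
theorem morreyBP_of_morreyTypeINear (hν : 0 < ν) (hMor : MorreyTypeINear u T) :
    ∃ M' : ℝ, 0 < M' ∧ ∃ r₀ : ℝ, 0 < r₀ ∧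
      ∀ (y : EuclideanSpace ℝ (Fin 3)) (r : ℝ), 0 < r → r < r₀ →
        ∀ t : ℝ, 0 < t → T - r ^ 2 / ν < t → t < T →
          eLpNorm (u t) 2 (volume.restrict (ball y r)) ≤ ENNReal.ofReal (M' * ν * Real.sqrt r) := by
  obtain ⟨M, hM, r₁, hr₁, hMr⟩ := hMor
  set κ : ℝ := Real.sqrt (1 + 2 / ν) with hκ
  have hκ2 : κ ^ 2 = 1 + 2 / ν := Real.sq_sqrt (by positivity)
  have hκpos : 0 < κ := Real.sqrt_pos.2 (by positivity)
  have hκ1 : 1 < κ := by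
    rw [← Real.sqrt_one, hκ]
    exact Real.sqrt_lt_sqrt zero_le_one (by linarith [div_pos two_pos hν])
  set M' : ℝ := Real.sqrt (M * κ) / ν with hM'
  have hM'pos : 0 < M' := by positivity
  refine ⟨M', hM'pos, r₁ / κ, div_pos hr₁ hκpos, fun y r hr hrr t _ht0 hwin htT => ?_⟩
  -- the inflated radius
  set r' : ℝ := r * κ with hr'
  have hr'pos : 0 < r' := mul_pos hr hκpos
  have hrr' : r ≤ r' := by
    rw [hr']; exact le_mul_of_one_le_right hr.le hκ1.le
  have hr'r₁ : r' < r₁ := by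
    rw [hr']; rwa [lt_div_iff₀ hκpos] at hrr
  have hwin' : T - r' ^ 2 < t := by
    have hν0 : ν ≠ 0 := hν.ne'
    have h1 : r ^ 2 / ν < r' ^ 2 := by
      rw [div_lt_iff₀ hν, hr', mul_pow, hκ2]
      have e : r ^ 2 * (1 + 2 / ν) * ν = r ^ 2 * (ν + 2) := by
        field_simp
      rw [e]
      have hr2 : 0 < r ^ 2 := pow_pos hr 2
      nlinarith
    linarith
  have hball := hMr y r' hr'pos hr'r₁ t hwin' htT
  have hmono : ∫⁻ x in ball y r, ‖u t x‖ₑ ^ 2 ≤ ENNReal.ofReal (M * r') :=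
    (lintegral_mono_set (ball_subset_ball hrr')).trans hball
  rw [eLpNorm_two_restrict_eq_lintegral_rpow]
  calc (∫⁻ x in ball y r, ‖u t x‖ₑ ^ 2) ^ (1 / 2 : ℝ)
      ≤ (ENNReal.ofReal (M * r')) ^ (1 / 2 : ℝ) := by gcongr
    _ = ENNReal.ofReal (Real.sqrt (M * r')) := by
        rw [Real.sqrt_eq_rpow, ENNReal.ofReal_rpow_of_nonneg (by positivity) (by norm_num)]
    _ = ENNReal.ofReal (M' * ν * Real.sqrt r) := by
        congr 1
        rw [hM', hr', show M * (r * κ) = (M * κ) * r by ring,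
          Real.sqrt_mul (by positivity : 0 ≤ M * κ)]
        field_simp

/-- **Interior regularity of a frame solution** in the `IsRegularPoint` currency (Tao 2013 closed-slab
bounds, `eLpNorm_uncurry_top_lt_top_of_tao2011`). [cite: Tao2011, Cor. 11.1] -/
theorem isRegularPoint_of_frame (hν : 0 < ν)
    (hcl : IsClassicalNSSolutionOn (Ico 0 T) ν 0 u p) (hLH : IsLerayHopfOn T ν 0 (u 0) u)
    (hdec : HasRapidSpatialDecay (u 0)) :
    ∀ t ∈ Ioo 0 T, ∀ x : EuclideanSpace ℝ (Fin 3), IsRegularPoint u (t, x) := fun _t ht x =>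
  isRegularPoint_of_eLpNorm_Icc_lt_top
    (eLpNorm_uncurry_top_lt_top_of_tao2011 tao2011_hasBoundedSobolevNormsOn_holds hν hcl hLH hdec) ht x

/-- **Concentration at every singular point, frame version.**  A frame solution of the Morrey-Type-I class
(`MorreyTypeINear u T`) has, at EVERY singular point `(T, x₀)` (`u` essentially unbounded on each backward
cylinder at `(T, x₀)`), constants `γ₃, c > 0` and a final window on which
`γ₃ < ‖u(t)‖_{L³(closedBall x₀ (c√(T-t)))}` (Barker–Prange 2020, Thm. 2; `γ₃ = γν`, `c = 2√(ν/S(M'))`).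
[cite: BarkerPrange2020, Thm. 2 (arXiv:1812.09115 pp. 4–5)] -/
theorem l3Concentration_at_singularPoint_of_morreyTypeINear (hν : 0 < ν) (hT : 0 < T)
    (hcl : IsClassicalNSSolutionOn (Ico 0 T) ν 0 u p) (hLH : IsLerayHopfOn T ν 0 (u 0) u)
    (hdec : HasRapidSpatialDecay (u 0)) (hMor : MorreyTypeINear u T) {x₀ : EuclideanSpace ℝ (Fin 3)}
    (hSing : ∀ r : ℝ, 0 < r → r ^ 2 < T →
      eLpNorm (uncurry u) ∞ (volume.restrict (parabolicCylinder r ((T : ℝ), x₀))) = ∞) :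
    ∃ γ₃ : ℝ, 0 < γ₃ ∧ ∃ c : ℝ, 0 < c ∧ ∃ T₁ ∈ Ico 0 T, ∀ t ∈ Ioo T₁ T,
      ENNReal.ofReal γ₃ < eLpNorm (u t) 3 (volume.restrict (closedBall x₀ (c * Real.sqrt (T - t)))) := by
  obtain ⟨M', hM', r₀, hr₀, hBP⟩ := morreyBP_of_morreyTypeINear (u := u) (T := T) hν hMor
  obtain ⟨γ, hγ, hM⟩ := l3Concentration_at_singularPoint_of_isLerayHopfOn
  obtain ⟨S, hS, -, hconc⟩ := hM M' hM'
  have hc : 0 < 2 * Real.sqrt (ν / S) := by positivity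
  refine ⟨γ * ν, by positivity, 2 * Real.sqrt (ν / S), hc, max 0 (T - S * r₀ ^ 2 / ν),
    ⟨le_max_left _ _, max_lt hT (by linarith [div_pos (by positivity : 0 < S * r₀ ^ 2) hν])⟩,
    fun t ht => ?_⟩
  have h := hconc ν T r₀ hν hT hr₀ (u 0) u hLH hBP (isRegularPoint_of_frame hν hcl hLH hdec) x₀ hSing t ht
  have hrad : 2 * Real.sqrt (ν * (T - t) / S) = 2 * Real.sqrt (ν / S) * Real.sqrt (T - t) := by
    rw [show ν * (T - t) / S = ν / S * (T - t) by ring,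
      Real.sqrt_mul (div_pos hν hS).le, mul_assoc]
  rwa [hrad] at h

/-- **Fixed-centre `L³` concentration on the Morrey-Type-I class of line `pace`.**  Every frame blow-up
(classical on `[0,T)`, Leray–Hopf from a rapidly decaying datum, NO smooth extension past `T`) obeying
`MorreyTypeINear u T` has a point `x₀` and constants `γ₃, c > 0` such that
`γ₃ < ‖u(t)‖_{L³(|x - x₀| ≤ c√(T-t))}` for all `t` of a final window — Barker–Prange 2020, Thm. 2, at a
singular point of the blow-up time (which exists: Lemarié-Rieusset 2016 Thm. 15.1 (C),
`exists_singularPoint_of_classical_of_not_hasSmoothExtensionPast`).  Contrast: for an ARBITRARY frame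
blow-up only a moving centre `x₀(t)` is known (`l3ParabolicConcentration_of_blowup`, p425306).
[cite: BarkerPrange2020, Thm. 2 (arXiv:1812.09115 pp. 4–5)] [cite: LemarieRieusset2016, Thm. 15.1 (C)] -/
theorem exists_fixedCentre_l3Concentration_of_morreyTypeINear (hν : 0 < ν) (hT : 0 < T)
    (hcl : IsClassicalNSSolutionOn (Ico 0 T) ν 0 u p) (hLH : IsLerayHopfOn T ν 0 (u 0) u)
    (hdec : HasRapidSpatialDecay (u 0)) (hnext : ¬ HasSmoothExtensionPast ν 0 u T)
    (hMor : MorreyTypeINear u T) :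
    ∃ x₀ : EuclideanSpace ℝ (Fin 3), ∃ γ₃ : ℝ, 0 < γ₃ ∧ ∃ c : ℝ, 0 < c ∧ ∃ T₁ ∈ Ico 0 T,
      ∀ t ∈ Ioo T₁ T,
        ENNReal.ofReal γ₃ < eLpNorm (u t) 3 (volume.restrict (closedBall x₀ (c * Real.sqrt (T - t)))) := by
  obtain ⟨x₀, hx₀⟩ := exists_singularPoint_of_classical_of_not_hasSmoothExtensionPast hν hT hcl hLH hdec hnext
  exact ⟨x₀, l3Concentration_at_singularPoint_of_morreyTypeINear hν hT hcl hLH hdec hMor hx₀⟩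

/-- The same in the `lintegral` currency of the pace line: `ofReal γ₃³ < ∫_{closedBall x₀ (c√(T-t))} |u(t)|³`
on a final window (cube of the `L³` norm). [cite: BarkerPrange2020, Thm. 2 (arXiv:1812.09115 pp. 4–5)] -/
theorem exists_fixedCentre_lintegral_cube_of_morreyTypeINear (hν : 0 < ν) (hT : 0 < T)
    (hcl : IsClassicalNSSolutionOn (Ico 0 T) ν 0 u p) (hLH : IsLerayHopfOn T ν 0 (u 0) u)
    (hdec : HasRapidSpatialDecay (u 0)) (hnext : ¬ HasSmoothExtensionPast ν 0 u T)
    (hMor : MorreyTypeINear u T) :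
    ∃ x₀ : EuclideanSpace ℝ (Fin 3), ∃ γ₃ : ℝ, 0 < γ₃ ∧ ∃ c : ℝ, 0 < c ∧ ∃ T₁ ∈ Ico 0 T,
      ∀ t ∈ Ioo T₁ T,
        ENNReal.ofReal (γ₃ ^ 3) < ∫⁻ x in closedBall x₀ (c * Real.sqrt (T - t)), ‖u t x‖ₑ ^ 3 := by
  obtain ⟨x₀, γ₃, hγ₃, c, hc, T₁, hT₁, hwin⟩ :=
    exists_fixedCentre_l3Concentration_of_morreyTypeINear hν hT hcl hLH hdec hnext hMor
  refine ⟨x₀, γ₃, hγ₃, c, hc, T₁, hT₁, fun t ht => ?_⟩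
  have h := hwin t ht
  -- `‖f‖_{L³(B)} = (∫_B ‖f‖³)^{1/3}`
  have h3 : eLpNorm (u t) 3 (volume.restrict (closedBall x₀ (c * Real.sqrt (T - t)))) =
      (∫⁻ x in closedBall x₀ (c * Real.sqrt (T - t)), ‖u t x‖ₑ ^ 3) ^ (1 / 3 : ℝ) := by
    rw [eLpNorm_eq_lintegral_rpow_enorm_toReal (by norm_num) (by norm_num), ENNReal.toReal_ofNat]
    congr 1
    refine lintegral_congr fun x => ?_
    rw [← ENNReal.rpow_natCast]
    norm_num
  rw [h3] at h
  have h' := ENNReal.rpow_lt_rpow h (show (0 : ℝ) < 3 by norm_num)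
  rw [← ENNReal.rpow_mul, show (1 / 3 : ℝ) * 3 = 1 by norm_num, ENNReal.rpow_one,
    ENNReal.ofReal_rpow_of_nonneg hγ₃.le (by norm_num)] at h'
  rwa [← Real.rpow_natCast, Nat.cast_ofNat]

/-- **Every sup-Type-I frame blow-up concentrates `L³` at a fixed centre** (Barker–Prange 2020, Thm. 2 with
the remark p. 5 that the pointwise Type-I rate gives (1.7); in the tree the uniform Morrey bound of a
sup-Type-I frame blow-up is `morreyTypeINear_of_typeI`, from `scaledEnergyBound_proof`).
[cite: BarkerPrange2020, Thm. 2 and remark p. 5 (arXiv:1812.09115 pp. 4–5)] -/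
theorem fixedCentre_l3Concentration_of_typeI_blowup (hν : 0 < ν) (hT : 0 < T)
    (hcl : IsClassicalNSSolutionOn (Ico 0 T) ν 0 u p) (hLH : IsLerayHopfOn T ν 0 (u 0) u)
    (hdec : HasRapidSpatialDecay (u 0)) (hnext : ¬ HasSmoothExtensionPast ν 0 u T)
    (hTI : IsTypeIBlowup u T) :
    ∃ x₀ : EuclideanSpace ℝ (Fin 3), ∃ γ₃ : ℝ, 0 < γ₃ ∧ ∃ c : ℝ, 0 < c ∧ ∃ T₁ ∈ Ico 0 T,
      ∀ t ∈ Ioo T₁ T,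
        ENNReal.ofReal γ₃ < eLpNorm (u t) 3 (volume.restrict (closedBall x₀ (c * Real.sqrt (T - t)))) :=
  exists_fixedCentre_l3Concentration_of_morreyTypeINear hν hT hcl hLH hdec hnext
    (morreyTypeINear_of_typeI hν hT hcl hLH hdec hTI)

end Summit.NavierStokesRegularity.NavierStokesRegularity.Theorems.L3TimeExponentPincerMorreyTypeIFixedCentre

end
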